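/-
Copyright (c) 2026 the pub-hodgecm-mathlib formalisation cell (harness21).  Prover seat hodgecm-mathlib-K2E3-p23 (g8), Track B «K2-LIT» ∕ hLiu418 #184♮,
Road I v3, unit U5 «THE CLOSE», FACE-D₀ row `h2₂`: (B1c′-2b-ii) THE LOCAL GRAM READING OF THE SIEGEL-UNIPOTENT CHIRP (LEAD F0P6-plan (g15) BATCH #181 (5) ∕
#183 (2); my OWED S-letters §2 of ★ p863351 `K2LiuFirstTermLineLiftRankRowSmallLetters`).  THEOREMS ONLY.
-/
import Summits.HodgeConjecture.HodgeConjecture.Theorems.K2LiuLocalRingTraceForm      -- ★ p863716 `trace_quadraticLocalEquiv` (`Tr = 2 re`), ★ `QuadraticLocalBaseChange` (`conjLocal_*`)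
import Literature.NumberTheory.Automorphic.QuadraticRestrictionOfScalars             -- ★ `IsQuadraticCoordinates`, `QuadraticCoordinates.re ∕ im`, `isQuadraticCoordinates_local`
import Literature.NumberTheory.Automorphic.QuadraticAdeleBaseChange                  -- ★ `quadraticAdeleEquiv`, `quadraticAdeleEquiv_symm_snd`, `quadraticFiniteAdeleEquiv_symm_apply_local`
import Literature.NumberTheory.Automorphic.UnitaryGroupLocalFactors                  -- ★ `continuous_conjLocal`
import Literature.NumberTheory.Automorphic.AdeleAddCharLocalNontrivial               -- ★ `isContinuousNontrivial_adeleAddCharAt`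
import Literature.RepresentationTheory.HeisenbergGroup.TateWeylPair                  -- ★ `isLocallyConstant_of_isContinuousNontrivial`
import Mathlib.LinearAlgebra.Matrix.Trace
import Mathlib.Topology.Instances.Matrix
import HarnessLib

/-!
# K2_Liu road (hLiu418 = stmt-HodgeConjecture-24832), U5 «THE CLOSE», FACE-D₀ row `h2₂`, (B1c′-2b-ii): THE LOCAL GRAM READING OF THE CHIRP —
# `⟨x, S′_u x⟩ = Tr_{E⊗F_v∕F_v} tr(b_u · a G(y))` WITH `b_u = δ · X_u T⁻¹` HERMITIAN AND `G(y) = σ(y) ⊗ y` THE GRAM MATRIX OF `y = T p − 2δ q`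

Cell `pub/hodgecm-mathlib` (D-0151), Track B, build stream 29; helper lane `--supports stmt-HodgeConjecture-24832 --as helper`, count-neutral; closes no socket.
THEOREMS ONLY (no `def`, no `instance`, no notation, no named-fact hypothesis, no `sorry`).

WHY.  ★ U2a's σ-explicit line model (★ `K2LiuRankOneLineGram.eq_zero_of_functional_rankTwo_conj`, consumed by ★ p863332
`K2LiuFirstTermLineLiftRankRowModelConj.h2Row_thetaSide_of_finLineModel_conj`) wants the finite Siegel unipotents `z` to act on `𝒮(𝔸_f^{n″})` by the multipliers
`x ↦ ψ(π (b z) (a • vecMulVec (σ ∘ v x) (v x)))` (letter `hρm`) with `π s H = Tr tr(s H)` (★ p863716 `hπ`), `b z` hermitian (letter `hb`), `σ a = a`.  The (B1c′) core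
(★ (K-d) `K2LiuDoubledDarbouxDeltaBlocks.coe_cayleyMover_conj_untransportSp_toSpD` + F0P2-p10 (g3) FILE 2 `K2LiuLinePairCayleySiegel` + K2Liu-p02 (g9) FILE 3) delivers the
action of `u ∈ N_Δ(𝔸)` in the `κ`-model as the CHIRP `finSdChar ((−⅟2) • cMat q_u)` (★ `finSdChar S x = ψ(⟨x S, x⟩)`, local reading ★ p863605
`finSdChar_map_finiteAdeleSingleHom`), whose block is `cMat q_u = a′ • (J₂ · Res(−2X_u) · D₂⁻¹)` with `J₂ = (0, 1; −2, 0)`, `D₂⁻¹ = (½, 0; 0, 1)` and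
`Res(Z) = (re Z, d • im Z · T⁻¹; T · im Z, T · re Z · T⁻¹)` the restriction of scalars of ★ (K-a)∕(K-b) in the coordinates `E ⊗ F_v = F_v ⊕ F_v δ` (`δ² = d`, `T = T₀ ⊗ 1`
the real Gram matrix).  THIS FILE is the pure algebra identifying the two quadratic forms:

* §1 (ring-generic, `IsQuadraticCoordinates φ Ψ δ d`, `σ ∘ φ = φ`, `σ δ = −δ`) **`re_trace_chirpGram`**: for every `X ∈ M_ι(S)`, `Ti ∈ M_ι(R)` and `p′, q : ι → R`, with
  `y_i := φ p′_i − 2 φ(q_i) δ`, `re tr((δ • X·Ti) · (σ(y) ⊗ y)) = d · (⟨Xi Ti p′, p′⟩ − 2⟨Xr Ti p′, q⟩ + 2⟨Xr Ti q, p′⟩ − 4d ⟨Xi Ti q, q⟩)` (`Xr = re X`, `Xi = im X`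
  entrywise) — expand in `δ`, reduce `δ² = φ d`, read off the `φ(R)`-component; **`chirpGram_quadratic_form`**: for `Tᵀ = T`, `Ti T = 1`, `p′ = p T`, that bracket is the
  quadratic form `⟨(p, q), M (p, q)⟩` of the block matrix **`M = (T Xi, 2 T Xr Ti; −2 Xr, −4d Xi Ti)`**; **`J₂_mul_res_mul_D₂inv`** ∕ **`neg_half_smul_chirpBlock`**: `M` IS
  `−(J₂ · Res(−2X) · D₂⁻¹)`, i.e. `(−⅟2) • (a′ • (J₂ Res(−2X) D₂⁻¹)) = (⅟2 · a′) • M` — the block of ★ (K-d) read at `Z = b₂₁ − b₁₂ = −2X_u`.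
* §2 **`re_quadraticAdeleEquiv_snd_apply`** ∕ **`im_…`** (+ matrix forms): the `v`-component of the adelic coordinates `re_𝔸 z`, `im_𝔸 z` of `z ∈ 𝔸_E` IS the local coordinate
  `re_v (z|_v)`, `im_v (z|_v)` of `z|_v ∈ E ⊗ F_v` (★ `quadraticAdeleEquiv_symm_snd`, ★ `quadraticFiniteAdeleEquiv_symm_apply_local`) — so the `v`-component of (K-d)'s adelic
  block is §1's local block.
* §3 AT `R := E ⊗_F F_v = LocalRing E v`, `σ := σ ⊗ 1 = conjLocal`, `Tr := Algebra.trace F_v R` (`Tr = 2 re`, ★ p863716 `trace_quadraticLocalEquiv`):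
  **`chirpGram_eq_trace`** — `⟨(p, q), ((⅟2·a′) • M)(p, q)⟩ = Tr tr((δ • X T⁻¹) · ((a′∕(4d)) • σ(y) ⊗ y))` with `y = ι(pT) − 2δ ι(q)`: U2a's `hρm` ARGUMENT
  `π (b z) (a • vecMulVec (σ ∘ v x) (v x))` with `b z := δ • X_z T⁻¹`, `a := ι_v(a′∕(4d))`, `v x := y(x|_v)`; **`chirpGram_eq_trace_of_blocks`** — the same ON
  ★ FILE 2c's BLOCK `(−h) • (a′ • (J₂ · Res(−X − X) · D₂(h)))` VERBATIM (`2h = 1`); and **`map_transpose_delta_smul_mul_inv`**: `b z` is `σ ⊗ 1`-HERMITIAN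
  whenever `X_z` is `T`-skew (`T X + σ(X)ᵀ T = 0`, ★ `skewMatrices`), the shape of U2a's letter `hb`.
* §4 U2a's letter **`hu`**: **`isLocallyConstant_multiplier`** — the multiplier `x ↦ ψ(π (b z) (a • σ(v x) ⊗ v x))` is locally constant for locally constant `ψ`,
  continuous `σ`, `π (b z) ·`, `v` (generic), with the instance inputs `isLocallyConstant_adeleAddCharAt`, `continuous_tracePairing`, `continuous_chirpVector`,
  `continuous_evalPlace_tuple`.
What stays with the (B1c′) core: the identification `cMat q_u = reindex (a′ • (J₂ Res(b₂₁ − b₁₂) D₂⁻¹))` and `b₂₁ − b₁₂ = −2X_u` on `N_Δ` (FILE 2 §5), and the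
reindexing `e₁′`.

References: [Kudla1994] S. S. Kudla, *Splitting metaplectic covers of dual reductive pairs*, Israel J. Math. 87 (1994) §2–§3 (the mixed model, the Siegel unipotent acting
by second-degree characters); [MoeglinVignerasWaldspurger1987] Chap. 2 II.2; [Rallis1984] §4; [KudlaRallis1994] §3 (the hermitian Gram pairing of the Fourier coefficient);
[CasselsFrohlichANT1967] Ch. II §10–§11, §14 (`E ⊗_F F_v`, `𝔸_E = 𝔸_F ⊕ 𝔸_F δ`); [Scharlau1985HermitianForms] Ch. 10 §1 (hermitian forms over rings with involution).
HONEST LABEL: HC_CM is proved only modulo the 7 printed citations (2 remaining named inputs: hLiu418 = stmt-HodgeConjecture-24832, h413 = stmt-HodgeConjecture-24833)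
until rung 0 closes; this file moves no counter; `h2₂` NOT discharged.
-/

set_option autoImplicit false
set_option linter.dupNamespace false -- the mandated namespace repeats `HodgeConjecture.HodgeConjecture`

noncomputable section

open scoped Matrix
open NumberField IsDedekindDomain
open Literature.NumberTheory.Automorphic Literature.NumberTheory.Automorphic.UnitaryGroup
open Literature.NumberTheory.Automorphic.UnitaryGroup.QuadraticCoordinates

namespace Summit.HodgeConjecture.HodgeConjecture.Cruxes.HLiu418.K2LiuFinChirpLocalGramReading

/-! ## §1 Ring-generic: the chirp block and the hermitian Gram pairing in quadratic coordinates -/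
section Generic

variable {R S : Type*} [CommRing R] [CommRing S] {φ : R →+* S} {Ψ : (R × R) ≃+ S} {δ : S} {d : R}
variable {ι : Type*} [Fintype ι]

/-- bilinear expansion of `⟨(δ′A + eB)(P + cQ), P − cQ⟩` into its eight elementary pairings. [folklore] -/
theorem dotProduct_expand (A B : Matrix ι ι S) (P Q : ι → S) (δ' e c : S) :
    ((δ' • A + e • B) *ᵥ (P + c • Q)) ⬝ᵥ (P - c • Q) =
      δ' * ((A *ᵥ P) ⬝ᵥ P) - δ' * c * ((A *ᵥ P) ⬝ᵥ Q) + δ' * c * ((A *ᵥ Q) ⬝ᵥ P) - δ' * c * c * ((A *ᵥ Q) ⬝ᵥ Q)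
      + e * ((B *ᵥ P) ⬝ᵥ P) - e * c * ((B *ᵥ P) ⬝ᵥ Q) + e * c * ((B *ᵥ Q) ⬝ᵥ P) - e * c * c * ((B *ᵥ Q) ⬝ᵥ Q) := by
  simp only [Matrix.add_mulVec, Matrix.smul_mulVec, Matrix.mulVec_add, Matrix.mulVec_smul, dotProduct_sub,
    add_dotProduct, smul_dotProduct, dotProduct_smul, smul_eq_mul, smul_add]
  ring

/-- `φ`-transport of an elementary pairing: `⟨φ(M) φ(u), φ(w)⟩ = φ ⟨M u, w⟩`. [folklore] -/
theorem map_mulVec_dotProduct (M : Matrix ι ι R) (u w : ι → R) :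
    (M.map φ *ᵥ (φ ∘ u)) ⬝ᵥ (φ ∘ w) = φ ((M *ᵥ u) ⬝ᵥ w) := by
  rw [RingHom.map_dotProduct]
  congr 1
  funext i
  exact (RingHom.map_mulVec φ M u i).symm

/-- **THE REAL PART OF THE HERMITIAN GRAM PAIRING OF THE CHIRP** (quadratic coordinates `S = φ(R) ⊕ φ(R)δ`, `δ² = φ d`, `σ ∘ φ = φ`, `σ δ = −δ`).  For `X ∈ M_ι(S)` with
coordinates `Xr = re X`, `Xi = im X`, any `Ti ∈ M_ι(R)` and `p′, q : ι → R`, the vector `y_i := φ p′_i − 2 φ(q_i) δ` (so `σ y_i = φ p′_i + 2 φ(q_i) δ`) satisfies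
`re tr((δ • X · φ(Ti)) · (σ(y) ⊗ y)) = d · (⟨Xi Ti p′, p′⟩ − 2 ⟨Xr Ti p′, q⟩ + 2 ⟨Xr Ti q, p′⟩ − 4d ⟨Xi Ti q, q⟩)` — expand in `δ`, reduce `δ² = φ d`, and read off the
`φ(R)`-component (`re (φ a + φ b · δ) = a`). [cite: Kudla1994, §3] [cite: Scharlau1985HermitianForms, Ch. 10 §1] -/
theorem re_trace_chirpGram (h : IsQuadraticCoordinates φ Ψ δ d) (σ : S →+* S) (hσφ : ∀ r, σ (φ r) = φ r) (hσδ : σ δ = -δ)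
    (X : Matrix ι ι S) (Ti : Matrix ι ι R) (p' q : ι → R) :
    re Ψ (Matrix.trace ((δ • (X * Ti.map φ)) *
        Matrix.vecMulVec (σ ∘ fun i => φ (p' i) - 2 * (φ (q i) * δ)) (fun i => φ (p' i) - 2 * (φ (q i) * δ)))) =
      d * (((X.map (im Ψ) * Ti) *ᵥ p') ⬝ᵥ p' - 2 * (((X.map (re Ψ) * Ti) *ᵥ p') ⬝ᵥ q) + 2 * (((X.map (re Ψ) * Ti) *ᵥ q) ⬝ᵥ p')
        - 4 * d * (((X.map (im Ψ) * Ti) *ᵥ q) ⬝ᵥ q)) := by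
  -- coordinates of `X` and of the two vectors
  have hX : X = (X.map (re Ψ)).map φ + δ • (X.map (im Ψ)).map φ := by
    ext i j
    simp only [Matrix.add_apply, Matrix.smul_apply, Matrix.map_apply, smul_eq_mul]
    rw [mul_comm δ]
    exact (h.re_add_im (X i j)).symm
  have hy : (fun i => φ (p' i) - 2 * (φ (q i) * δ)) = φ ∘ p' - (2 * δ) • (φ ∘ q) := by
    funext i
    simp only [Pi.sub_apply, Pi.smul_apply, Function.comp_apply, smul_eq_mul]
    ring
  have hσy : (σ ∘ fun i => φ (p' i) - 2 * (φ (q i) * δ)) = φ ∘ p' + (2 * δ) • (φ ∘ q) := by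
    funext i
    simp only [Pi.add_apply, Pi.smul_apply, Function.comp_apply, smul_eq_mul, map_sub, map_mul, map_ofNat, hσφ, hσδ]
    ring
  have hK : δ • (X * Ti.map φ) = δ • (X.map (re Ψ) * Ti).map φ + φ d • (X.map (im Ψ) * Ti).map φ := by
    conv_lhs => rw [hX]
    rw [Matrix.add_mul, Matrix.smul_mul, Matrix.map_mul, Matrix.map_mul, smul_add, smul_smul, h.mul_self]
  rw [Matrix.mul_vecMulVec, Matrix.trace_vecMulVec, hσy, hy, hK, dotProduct_expand]
  simp only [map_mulVec_dotProduct]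
  -- a polynomial in `δ` with coefficients in `φ(R)`: reduce with `δ² = φ d` and read off the real part
  set r₁ := ((X.map (re Ψ) * Ti) *ᵥ p') ⬝ᵥ p'
  set r₂ := ((X.map (re Ψ) * Ti) *ᵥ p') ⬝ᵥ q
  set r₃ := ((X.map (re Ψ) * Ti) *ᵥ q) ⬝ᵥ p'
  set r₄ := ((X.map (re Ψ) * Ti) *ᵥ q) ⬝ᵥ q
  set r₅ := ((X.map (im Ψ) * Ti) *ᵥ p') ⬝ᵥ p'
  set r₆ := ((X.map (im Ψ) * Ti) *ᵥ p') ⬝ᵥ q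
  set r₇ := ((X.map (im Ψ) * Ti) *ᵥ q) ⬝ᵥ p'
  set r₈ := ((X.map (im Ψ) * Ti) *ᵥ q) ⬝ᵥ q
  have hZ : δ * φ r₁ - δ * (2 * δ) * φ r₂ + δ * (2 * δ) * φ r₃ - δ * (2 * δ) * (2 * δ) * φ r₄ + φ d * φ r₅ - φ d * (2 * δ) * φ r₆
      + φ d * (2 * δ) * φ r₇ - φ d * (2 * δ) * (2 * δ) * φ r₈ =
      φ (d * (r₅ - 2 * r₂ + 2 * r₃ - 4 * d * r₈)) + φ (r₁ - 2 * d * r₆ + 2 * d * r₇ - 4 * d * r₄) * δ := by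
    simp only [map_add, map_sub, map_mul, map_ofNat]
    linear_combination (-2 * φ r₂ + 2 * φ r₃ - 4 * φ d * φ r₈ - 4 * δ * φ r₄) * h.mul_self
  rw [hZ, h.re_eq]

/-- **THE BRACKET IS THE QUADRATIC FORM OF THE CHIRP BLOCK**: for `Tᵀ = T`, `Ti · T = 1` and `p′ = p T` (row vector),
`⟨Xi Ti p′, p′⟩ − 2 ⟨Xr Ti p′, q⟩ + 2 ⟨Xr Ti q, p′⟩ − 4d ⟨Xi Ti q, q⟩ = ⟨(p, q) M, (p, q)⟩` with `M = (T Xi, 2 T Xr Ti; −2 Xr, −4d Xi Ti)` (ring-generic).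
[cite: Kudla1994, §3] [cite: MoeglinVignerasWaldspurger1987, Chap. 2 II.2] -/
theorem chirpGram_quadratic_form [DecidableEq ι] (Xr Xi T Ti : Matrix ι ι R) (hT : Tᵀ = T) (hTi : Ti * T = 1) (d : R) (p q : ι → R) :
    ((Xi * Ti) *ᵥ (p ᵥ* T)) ⬝ᵥ (p ᵥ* T) - 2 * (((Xr * Ti) *ᵥ (p ᵥ* T)) ⬝ᵥ q) + 2 * (((Xr * Ti) *ᵥ q) ⬝ᵥ (p ᵥ* T)) - 4 * d * (((Xi * Ti) *ᵥ q) ⬝ᵥ q) =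
      Sum.elim p q ᵥ* Matrix.fromBlocks (T * Xi) ((2 : R) • (T * Xr * Ti)) (-((2 : R) • Xr)) (-((4 * d) • (Xi * Ti))) ⬝ᵥ Sum.elim p q := by
  -- `⟨w, p T⟩ = ⟨w T, p⟩` for symmetric `T`
  have hdot : ∀ w : ι → R, w ⬝ᵥ (p ᵥ* T) = (w ᵥ* T) ⬝ᵥ p := fun w => by
    rw [← Matrix.mulVec_transpose, hT, Matrix.dotProduct_mulVec]
  have e1 : ((Xi * Ti) *ᵥ (p ᵥ* T)) ⬝ᵥ (p ᵥ* T) = (p ᵥ* (T * Xi)) ⬝ᵥ p := by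
    rw [dotProduct_comm, Matrix.dotProduct_mulVec, hdot]
    simp only [Matrix.vecMul_vecMul, Matrix.mul_assoc, hTi, Matrix.mul_one]
  have e2 : ((Xr * Ti) *ᵥ (p ᵥ* T)) ⬝ᵥ q = (q ᵥ* Xr) ⬝ᵥ p := by
    rw [dotProduct_comm, Matrix.dotProduct_mulVec, hdot]
    simp only [Matrix.vecMul_vecMul, Matrix.mul_assoc, hTi, Matrix.mul_one]
  have e3 : ((Xr * Ti) *ᵥ q) ⬝ᵥ (p ᵥ* T) = (p ᵥ* (T * Xr * Ti)) ⬝ᵥ q := by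
    rw [dotProduct_comm, Matrix.dotProduct_mulVec, Matrix.vecMul_vecMul, Matrix.mul_assoc]
  have e4 : ((Xi * Ti) *ᵥ q) ⬝ᵥ q = (q ᵥ* (Xi * Ti)) ⬝ᵥ q := by
    rw [dotProduct_comm, Matrix.dotProduct_mulVec]
  rw [e1, e2, e3, e4, Matrix.vecMul_fromBlocks, sumElim_dotProduct_sumElim, Sum.elim_comp_inl, Sum.elim_comp_inr, add_dotProduct, add_dotProduct,
    Matrix.vecMul_smul, Matrix.vecMul_neg, Matrix.vecMul_neg, Matrix.vecMul_smul, Matrix.vecMul_smul, smul_dotProduct, neg_dotProduct, neg_dotProduct,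
    smul_dotProduct, smul_dotProduct, smul_eq_mul, smul_eq_mul, smul_eq_mul]
  ring

/-- **THE BLOCK ALGEBRA OF ★ (K-d)'s CHIRP BLOCK**: `J₂ · Res(Z) · D₂⁻¹ = (½ T Zi, T Zr Ti; −Zr, −2d Zi Ti)` for `J₂ = (0, 1; −2, 0)`, `D₂⁻¹ = (½, 0; 0, 1)`,
`Res(Z) = (Zr, d • Zi Ti; T Zi, T Zr Ti)` (ring-generic; `½` is any `h` with `2h = 1`, e.g. `⅟2`). [cite: Kudla1994, §3] [cite: MoeglinVignerasWaldspurger1987, Chap. 2 II.2] -/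
theorem J₂_mul_res_mul_D₂inv [DecidableEq ι] (h : R) (h2 : 2 * h = 1) (Zr Zi T Ti : Matrix ι ι R) (d : R) :
    Matrix.fromBlocks 0 1 (-((2 : R) • (1 : Matrix ι ι R))) 0 * Matrix.fromBlocks Zr (d • (Zi * Ti)) (T * Zi) (T * Zr * Ti) *
        Matrix.fromBlocks (h • (1 : Matrix ι ι R)) 0 0 1 =
      Matrix.fromBlocks (h • (T * Zi)) (T * Zr * Ti) (-Zr) (-((2 * d) • (Zi * Ti))) := by
  have h2' : h * 2 = 1 := by rw [mul_comm]; exact h2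
  have hd2 : d * 2 = 2 * d := mul_comm _ _
  rw [Matrix.fromBlocks_multiply, Matrix.fromBlocks_multiply]
  simp only [Matrix.zero_mul, Matrix.one_mul, zero_add, add_zero, Matrix.mul_zero, Matrix.mul_one, Matrix.neg_mul, Matrix.smul_mul,
    Matrix.mul_smul, smul_zero, smul_neg, smul_smul, h2', hd2, one_smul]

/-- **`(−½) • (a′ • (J₂ Res(−2X) D₂⁻¹)) = (½ a′) • M`** with `M = (T Xi, 2 T Xr Ti; −2 Xr, −4d Xi Ti)`: the chirp parameter `(−⅟2) • cMat q_u` of the `κ`-model (FILE 3's head,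
`cMat q_u = a′ • (J₂ Res(b₂₁ − b₁₂) D₂⁻¹)` with `b₂₁ − b₁₂ = −2X_u` on `N_Δ`) in the form consumed by `chirpGram_quadratic_form` (ring-generic; `½` is any `h` with `2h = 1`;
`Zr = −2Xr`, `Zi = −2Xi`). [cite: Kudla1994, §3] [cite: MoeglinVignerasWaldspurger1987, Chap. 2 II.2] -/
theorem neg_half_smul_chirpBlock [DecidableEq ι] (h : R) (h2 : 2 * h = 1) (Xr Xi T Ti : Matrix ι ι R) (d a' : R) :
    (-h) • (a' • (Matrix.fromBlocks 0 1 (-((2 : R) • (1 : Matrix ι ι R))) 0 *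
        Matrix.fromBlocks (-((2 : R) • Xr)) (d • (-((2 : R) • Xi) * Ti)) (T * -((2 : R) • Xi)) (T * -((2 : R) • Xr) * Ti) *
        Matrix.fromBlocks (h • (1 : Matrix ι ι R)) 0 0 1)) =
      (h * a') • Matrix.fromBlocks (T * Xi) ((2 : R) • (T * Xr * Ti)) (-((2 : R) • Xr)) (-((4 * d) • (Xi * Ti))) := by
  have h2' : h * 2 = 1 := by rw [mul_comm]; exact h2
  have h4 : -h * a' * (2 * d * 2) = h * a' * -(4 * d) := by ring
  rw [J₂_mul_res_mul_D₂inv h h2, smul_smul, Matrix.fromBlocks_smul, Matrix.fromBlocks_smul]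
  simp only [Matrix.mul_neg, Matrix.neg_mul, Matrix.mul_smul, Matrix.smul_mul, smul_neg, neg_neg, smul_smul]
  congr 1
  · rw [show -h * a' * (h * 2) = -(h * a') by rw [h2', mul_one, neg_mul], neg_smul, neg_neg]
  · rw [show -h * a' * 2 = -(h * a' * 2) by ring, neg_smul, neg_neg]
  · rw [show -h * a' * 2 = -(h * a' * 2) by ring, neg_smul]
  · rw [h4, mul_neg, neg_smul]

end Generic

/-! ## §2 The `v`-component of the adelic coordinates is the local coordinate -/
section AdeleLocal

variable (F E : Type) [Field F] [NumberField F] [Field E] [NumberField E] [Algebra F E] [Algebra.IsQuadraticExtension F E]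
  (v : HeightOneSpectrum (𝓞 F)) (σ : E ≃ₐ[F] E) {δ : E} (hσδ : σ δ = -δ) (hδ : δ ≠ 0)

/-- **`(re_𝔸 z)_v = re_v (z|_v)`**: the `v`-component of the first adelic coordinate of `z ∈ 𝔸_E = 𝔸_F ⊕ 𝔸_F δ` is the first local coordinate of `z|_v ∈ E ⊗ F_v = F_v ⊕ F_v δ`
(★ `quadraticAdeleEquiv_symm_snd`, ★ `quadraticFiniteAdeleEquiv_symm_apply_local`). [cite: CasselsFrohlichANT1967, Ch. II §14] -/
theorem re_quadraticAdeleEquiv_snd_apply (z : AdeleRing (𝓞 E) E) :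
    (re (quadraticAdeleEquiv F E σ hσδ hδ).toAddEquiv z).2 v =
      re (quadraticLocalEquiv E v σ hσδ hδ).toLinearEquiv.toAddEquiv (finiteAdeleToLocal E v z.2) := by
  have h1 := congrArg Prod.fst (quadraticAdeleEquiv_symm_snd E σ hσδ hδ z)
  have h2 := congrArg Prod.fst (quadraticFiniteAdeleEquiv_symm_apply_local E σ hσδ hδ z.2 v)
  rw [re_def, re_def]
  exact (congrArg (fun a : FiniteAdeleRing (𝓞 F) F => a v) h1).trans h2

/-- **`(im_𝔸 z)_v = im_v (z|_v)`** (second coordinate). [cite: CasselsFrohlichANT1967, Ch. II §14] -/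
theorem im_quadraticAdeleEquiv_snd_apply (z : AdeleRing (𝓞 E) E) :
    (im (quadraticAdeleEquiv F E σ hσδ hδ).toAddEquiv z).2 v =
      im (quadraticLocalEquiv E v σ hσδ hδ).toLinearEquiv.toAddEquiv (finiteAdeleToLocal E v z.2) := by
  have h1 := congrArg Prod.snd (quadraticAdeleEquiv_symm_snd E σ hσδ hδ z)
  have h2 := congrArg Prod.snd (quadraticFiniteAdeleEquiv_symm_apply_local E σ hσδ hδ z.2 v)
  rw [im_def, im_def]
  exact (congrArg (fun a : FiniteAdeleRing (𝓞 F) F => a v) h1).trans h2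

/-- matrix form: the `v`-components of `re_𝔸 Z` are `re_v (Z|_v)`. [cite: CasselsFrohlichANT1967, Ch. II §14] -/
theorem map_re_quadraticAdeleEquiv_snd_apply {m n : Type*} (Z : Matrix m n (AdeleRing (𝓞 E) E)) :
    (Z.map (re (quadraticAdeleEquiv F E σ hσδ hδ).toAddEquiv)).map (fun a : AdeleRing (𝓞 F) F => a.2 v) =
      (Z.map (fun z : AdeleRing (𝓞 E) E => finiteAdeleToLocal E v z.2)).map (re (quadraticLocalEquiv E v σ hσδ hδ).toLinearEquiv.toAddEquiv) :=
  Matrix.ext fun i j => re_quadraticAdeleEquiv_snd_apply F E v σ hσδ hδ (Z i j)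

/-- matrix form: the `v`-components of `im_𝔸 Z` are `im_v (Z|_v)`. [cite: CasselsFrohlichANT1967, Ch. II §14] -/
theorem map_im_quadraticAdeleEquiv_snd_apply {m n : Type*} (Z : Matrix m n (AdeleRing (𝓞 E) E)) :
    (Z.map (im (quadraticAdeleEquiv F E σ hσδ hδ).toAddEquiv)).map (fun a : AdeleRing (𝓞 F) F => a.2 v) =
      (Z.map (fun z : AdeleRing (𝓞 E) E => finiteAdeleToLocal E v z.2)).map (im (quadraticLocalEquiv E v σ hσδ hδ).toLinearEquiv.toAddEquiv) :=
  Matrix.ext fun i j => im_quadraticAdeleEquiv_snd_apply F E v σ hσδ hδ (Z i j)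

end AdeleLocal

/-! ## §3 At `R := E ⊗_F F_v`, `σ := σ ⊗ 1`, `Tr := Algebra.trace`: U2a's `hρm` argument and the hermitian dressing `b z = δ • X T⁻¹` -/
section LocalRing

variable (F E : Type) [Field F] [NumberField F] [Field E] [NumberField E] [Algebra F E] [Algebra.IsQuadraticExtension F E]
  (v : HeightOneSpectrum (𝓞 F)) (σ : E ≃ₐ[F] E) {δ : E} (hσδ : σ δ = -δ) (hδ : δ ≠ 0) {d : F} (hd : δ * δ = algebraMap F E d)
variable {ι : Type*} [Fintype ι] [DecidableEq ι]

include hσδ hδ in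
/-- **`Tr = 2 re`** on `E ⊗_F F_v` in the coordinates `(1, δ)` (★ p863716 `trace_quadraticLocalEquiv`). [cite: CasselsFrohlichANT1967, Ch. II §19 (19.9)] -/
theorem algebraTrace_eq_two_mul_re (z : LocalRing E v) :
    Algebra.trace (v.adicCompletion F) (LocalRing E v) z = 2 * re (quadraticLocalEquiv E v σ hσδ hδ).toLinearEquiv.toAddEquiv z := by
  have h := K2LiuLocalRingTraceForm.trace_quadraticLocalEquiv F E v σ hσδ hδ (re (quadraticLocalEquiv E v σ hσδ hδ).toLinearEquiv.toAddEquiv z)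
    (im (quadraticLocalEquiv E v σ hσδ hδ).toLinearEquiv.toAddEquiv z)
  have hz : quadraticLocalEquiv E v σ hσδ hδ (re (quadraticLocalEquiv E v σ hσδ hδ).toLinearEquiv.toAddEquiv z,
      im (quadraticLocalEquiv E v σ hσδ hδ).toLinearEquiv.toAddEquiv z) = z :=
    apply_re_im (quadraticLocalEquiv E v σ hσδ hδ).toLinearEquiv.toAddEquiv z
  rw [hz] at h
  rw [h, two_smul, two_mul]

include hd in
/-- **THE LOCAL GRAM READING OF THE CHIRP — U2a's `hρm` ARGUMENT.**  At a finite place `v` of `F`, for `X ∈ M_ι(E ⊗ F_v)` with local coordinates `Xr = re_v X`,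
`Xi = im_v X`, a symmetric invertible `T ∈ M_ι(F_v)`, `p q : ι → F_v` and `a′ ∈ F_v`:
`⟨(p, q), ((½ a′) • M)(p, q)⟩ = Tr_{E⊗F_v∕F_v} tr((δ • X T⁻¹) · ((a′∕(4d)) • σ(y) ⊗ y))` with `M = (T Xi, 2 T Xr T⁻¹; −2 Xr, −4d Xi T⁻¹)` and
`y_i = ι_v((pT)_i) − 2 ι_v(q_i) δ` — i.e. the chirp `ψ_{F,v}(⟨x_v, ((−½) • cMat q_u)_v x_v⟩)` of the `κ`-model IS `ψ(π (b z) (a • vecMulVec (σ ∘ v x) (v x)))` with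
`π s H = Tr tr(s H)`, `b z := δ • X_z T⁻¹`, `a := ι_v(a′∕(4d))`, `v x := y`. (§1 `re_trace_chirpGram` ∘ `chirpGram_quadratic_form`, `Tr = 2 re`.)
[cite: Kudla1994, §3] [cite: Rallis1984, §4] [cite: KudlaRallis1994, §3] -/
theorem chirpGram_eq_trace (X : Matrix ι ι (LocalRing E v)) (T : Matrix ι ι (v.adicCompletion F)) (hT : Tᵀ = T) (hTu : IsUnit T.det)
    (p q : ι → v.adicCompletion F) (a' : v.adicCompletion F) :
    Sum.elim p q ᵥ* (((2 : v.adicCompletion F)⁻¹ * a') •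
        Matrix.fromBlocks (T * X.map (im (quadraticLocalEquiv E v σ hσδ hδ).toLinearEquiv.toAddEquiv))
          ((2 : v.adicCompletion F) • (T * X.map (re (quadraticLocalEquiv E v σ hσδ hδ).toLinearEquiv.toAddEquiv) * T⁻¹))
          (-((2 : v.adicCompletion F) • X.map (re (quadraticLocalEquiv E v σ hσδ hδ).toLinearEquiv.toAddEquiv)))
          (-((4 * (d : v.adicCompletion F)) • (X.map (im (quadraticLocalEquiv E v σ hσδ hδ).toLinearEquiv.toAddEquiv) * T⁻¹)))) ⬝ᵥ Sum.elim p q =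
      Algebra.trace (v.adicCompletion F) (LocalRing E v) (Matrix.trace
        ((algebraMap E (LocalRing E v) δ • (X * T⁻¹.map (toLocalRing E v))) *
          (toLocalRing E v (a' / (4 * (d : v.adicCompletion F))) •
            Matrix.vecMulVec (conjLocal E σ v ∘ fun i => toLocalRing E v ((p ᵥ* T) i) - 2 * (toLocalRing E v (q i) * algebraMap E (LocalRing E v) δ))
              (fun i => toLocalRing E v ((p ᵥ* T) i) - 2 * (toLocalRing E v (q i) * algebraMap E (LocalRing E v) δ))))) := by
  haveI : CharZero (v.adicCompletion F) := charZero_of_injective_algebraMap (algebraMap F (v.adicCompletion F)).injective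
  have hd0 : (d : v.adicCompletion F) ≠ 0 := by
    have hdF : d ≠ 0 := by
      rintro rfl
      rw [map_zero, mul_self_eq_zero] at hd
      exact hδ hd
    exact fun h0 => hdF ((algebraMap F (v.adicCompletion F)).injective (h0.trans (map_zero _).symm))
  have hq := isQuadraticCoordinates_local E v σ hσδ hδ hd
  -- pull the scalar `a′∕(4d)` out of the traces
  rw [Matrix.mul_smul, Matrix.trace_smul, smul_eq_mul, ← algebraMap_localRing_eq, ← Algebra.smul_def, map_smul, smul_eq_mul,
    algebraTrace_eq_two_mul_re F E v σ hσδ hδ, algebraMap_localRing_eq,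
    re_trace_chirpGram hq (conjLocal E σ v) (conjLocal_toLocalRing σ v) (by rw [conjLocal_algebraMap, hσδ, map_neg]) X T⁻¹ (p ᵥ* T) q,
    chirpGram_quadratic_form _ _ T T⁻¹ hT (Matrix.nonsing_inv_mul T hTu) (d : v.adicCompletion F) p q, Matrix.vecMul_smul, smul_dotProduct, smul_eq_mul]
  field_simp
  ring

include hd in
/-- **THE SAME, ON ★ FILE 2c's BLOCK VERBATIM** (`K2LiuLinePairCayleySiegelUnipotent.aMat_cMat_lineKappa_of_mem_unipDelta`, read at `v`): for `2h = 1`,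
`⟨(p, q), ((−h) • (a′ • (J₂ · Res(−X − X) · D₂(h))))(p, q)⟩ = Tr_{E⊗F_v∕F_v} tr((δ • X T⁻¹) · ((a′∕(4d)) • σ(y) ⊗ y))` with
`Res(Z) = (Z.map re, d • (Z.map im · T⁻¹); T · Z.map im, T · Z.map re · T⁻¹)`, `J₂ = (0, 1; −(2 • 1), 0)`, `D₂(h) = (h • 1, 0; 0, 1)` — the chirp `(−⅟2) • cMat q_u`
of the `κ`-model at the place `v`, up to the reindexing `e₁′ ∘ e₂` and the factor `1ᵀ`, IS U2a's `hρm` argument. [cite: Kudla1994, §3] [cite: Rallis1984, §4] -/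
theorem chirpGram_eq_trace_of_blocks (X : Matrix ι ι (LocalRing E v)) (T : Matrix ι ι (v.adicCompletion F)) (hT : Tᵀ = T) (hTu : IsUnit T.det)
    (p q : ι → v.adicCompletion F) (a' h : v.adicCompletion F) (h2 : 2 * h = 1) :
    Sum.elim p q ᵥ* ((-h) • (a' • (Matrix.fromBlocks 0 1 (-((2 : v.adicCompletion F) • (1 : Matrix ι ι (v.adicCompletion F)))) 0 *
        Matrix.fromBlocks ((-X - X).map (re (quadraticLocalEquiv E v σ hσδ hδ).toLinearEquiv.toAddEquiv))
          ((d : v.adicCompletion F) • ((-X - X).map (im (quadraticLocalEquiv E v σ hσδ hδ).toLinearEquiv.toAddEquiv) * T⁻¹))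
          (T * (-X - X).map (im (quadraticLocalEquiv E v σ hσδ hδ).toLinearEquiv.toAddEquiv))
          (T * (-X - X).map (re (quadraticLocalEquiv E v σ hσδ hδ).toLinearEquiv.toAddEquiv) * T⁻¹) *
        Matrix.fromBlocks (h • (1 : Matrix ι ι (v.adicCompletion F))) 0 0 1))) ⬝ᵥ Sum.elim p q =
      Algebra.trace (v.adicCompletion F) (LocalRing E v) (Matrix.trace
        ((algebraMap E (LocalRing E v) δ • (X * T⁻¹.map (toLocalRing E v))) *
          (toLocalRing E v (a' / (4 * (d : v.adicCompletion F))) •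
            Matrix.vecMulVec (conjLocal E σ v ∘ fun i => toLocalRing E v ((p ᵥ* T) i) - 2 * (toLocalRing E v (q i) * algebraMap E (LocalRing E v) δ))
              (fun i => toLocalRing E v ((p ᵥ* T) i) - 2 * (toLocalRing E v (q i) * algebraMap E (LocalRing E v) δ))))) := by
  have hre : (-X - X).map (re (quadraticLocalEquiv E v σ hσδ hδ).toLinearEquiv.toAddEquiv) =
      -((2 : v.adicCompletion F) • X.map (re (quadraticLocalEquiv E v σ hσδ hδ).toLinearEquiv.toAddEquiv)) := by
    rw [Matrix.map_sub _ (map_sub _), Matrix.map_neg _ (map_neg _), two_smul]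
    abel
  have him : (-X - X).map (im (quadraticLocalEquiv E v σ hσδ hδ).toLinearEquiv.toAddEquiv) =
      -((2 : v.adicCompletion F) • X.map (im (quadraticLocalEquiv E v σ hσδ hδ).toLinearEquiv.toAddEquiv)) := by
    rw [Matrix.map_sub _ (map_sub _), Matrix.map_neg _ (map_neg _), two_smul]
    abel
  rw [hre, him, neg_half_smul_chirpBlock h h2, ← inv_eq_of_mul_eq_one_right h2]
  exact chirpGram_eq_trace F E v σ hσδ hδ hd X T hT hTu p q a'

/-- **`b z := δ • X T⁻¹` IS `σ ⊗ 1`-HERMITIAN FOR `T`-SKEW `X`** (ring-generic: `σ` a ring endomorphism fixing the symmetric invertible `T`, `σ δ = −δ`,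
`T X + σ(X)ᵀ T = 0` ⇒ `(σ(δ • X T⁻¹))ᵀ = δ • X T⁻¹`) — the shape of U2a's letter `hb` (★ `skewMatrices σ T` is the coordinate group of `N_Δ`).
[cite: Scharlau1985HermitianForms, Ch. 10 §1] [cite: Shimura1997, §18.1] -/
theorem map_transpose_delta_smul_mul_inv {A : Type*} [CommRing A] (τ : A →+* A) (δA : A) (hτδ : τ δA = -δA) (T X : Matrix ι ι A)
    (hTτ : T.map τ = T) (hT : Tᵀ = T) (hTu : IsUnit T.det) (hX : T * X + (X.map τ)ᵀ * T = 0) :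
    ((δA • (X * T⁻¹)).map τ)ᵀ = δA • (X * T⁻¹) := by
  have hTi : T⁻¹.map τ = T⁻¹ := by
    have h1 : T.map τ * T⁻¹.map τ = 1 := by rw [← Matrix.map_mul, Matrix.mul_nonsing_inv T hTu, Matrix.map_one _ (map_zero τ) (map_one τ)]
    rw [hTτ] at h1
    calc T⁻¹.map τ = T⁻¹ * (T * T⁻¹.map τ) := by rw [← Matrix.mul_assoc, Matrix.nonsing_inv_mul T hTu, Matrix.one_mul]
      _ = T⁻¹ := by rw [h1, Matrix.mul_one]
  -- `σ(X)ᵀ = −T X T⁻¹`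
  have hXt : (X.map τ)ᵀ = -(T * X * T⁻¹) := by
    have h2 : (X.map τ)ᵀ * T = -(T * X) := eq_neg_of_add_eq_zero_right hX
    calc (X.map τ)ᵀ = (X.map τ)ᵀ * T * T⁻¹ := by rw [Matrix.mul_assoc, Matrix.mul_nonsing_inv T hTu, Matrix.mul_one]
      _ = -(T * X * T⁻¹) := by rw [h2, Matrix.neg_mul]
  have hTit : (T⁻¹)ᵀ = T⁻¹ := by rw [Matrix.transpose_nonsing_inv, hT]
  rw [Matrix.map_smul' _ _ _ (map_mul τ), Matrix.transpose_smul, hτδ, Matrix.map_mul, hTi, Matrix.transpose_mul, hTit, hXt, Matrix.mul_neg,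
    smul_neg, neg_smul, neg_neg, ← Matrix.mul_assoc, ← Matrix.mul_assoc, Matrix.nonsing_inv_mul T hTu, Matrix.one_mul]

end LocalRing

/-! ## §4 U2a's letter `hu`: the chirp multiplier is locally constant -/
section LocallyConstant

/-- **U2a's LETTER `hu`, GENERIC FORM**: if `ψ` is locally constant (a continuous non-trivial additive character of a non-archimedean local field, ★
`isLocallyConstant_of_isContinuousNontrivial`), `σ` and `π (b z) ·` are continuous and the coordinate map `v` is continuous, then the multiplier
`x ↦ ψ(π (b z) (a • σ(v x) ⊗ v x))` is locally constant (Mathlib `IsLocallyConstant.comp_continuous`, `Continuous.matrix_vecMulVec`).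
[cite: Kudla1994, §3] [cite: Weil1964, n° 13] -/
theorem isLocallyConstant_multiplier {X : Type*} [TopologicalSpace X] {R : Type*} [CommRing R] [TopologicalSpace R] [IsTopologicalRing R]
    {F : Type*} [Field F] [Algebra F R] [TopologicalSpace F] (σ : R →+* R) (hσc : Continuous σ)
    (π : Matrix (Fin 2) (Fin 2) R →ₗ[F] Matrix (Fin 2) (Fin 2) R →ₗ[F] F) (ψ : AddChar F Circle) (hψ : IsLocallyConstant (⇑ψ : F → Circle))
    {Z : Type*} (b : Z → Matrix (Fin 2) (Fin 2) R) (hπc : ∀ z, Continuous (π (b z))) (a : R) (v : X → Fin 2 → R) (hv : Continuous v) (z : Z) :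
    IsLocallyConstant fun x => ((ψ (π (b z) (a • Matrix.vecMulVec (⇑σ ∘ v x) (v x))) : Circle) : ℂ) := by
  have hG : Continuous fun x => a • Matrix.vecMulVec (⇑σ ∘ v x) (v x) :=
    ((continuous_pi fun i => hσc.comp ((continuous_apply i).comp hv)).matrix_vecMulVec hv).const_smul a
  exact ((hψ.comp_continuous (hπc z)).comp_continuous hG).comp (fun c : Circle => (c : ℂ))

variable (F E : Type) [Field F] [NumberField F] [Field E] [NumberField E] [Algebra F E] (v : HeightOneSpectrum (𝓞 F))

/-- `ψ_{F,v}` is locally constant (★ `isContinuousNontrivial_adeleAddCharAt`, ★ `isLocallyConstant_of_isContinuousNontrivial`). [cite: Weil1964, n° 13] -/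
theorem isLocallyConstant_adeleAddCharAt : IsLocallyConstant (⇑(adeleAddCharAt F v) : v.adicCompletion F → Circle) :=
  Literature.RepresentationTheory.HeisenbergGroup.isLocallyConstant_of_isContinuousNontrivial (isContinuousNontrivial_adeleAddCharAt F v)

/-- the trace pairing `H ↦ Tr_{E⊗F_v∕F_v} tr(s · H)` is continuous on `M₂(E ⊗ F_v)` (★ K2Liu-p12 `continuous_algebraTrace_localRing`). [cite: CasselsFrohlichANT1967, Ch. II §11] -/
theorem continuous_tracePairing [Algebra.IsQuadraticExtension F E] {m : Type*} [Fintype m] (s : Matrix m m (LocalRing E v)) :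
    Continuous fun H : Matrix m m (LocalRing E v) => Algebra.trace (v.adicCompletion F) (LocalRing E v) (Matrix.trace (s * H)) :=
  (K2LiuTateCharacterLocalTrace.continuous_algebraTrace_localRing E v).comp ((continuous_const.matrix_mul continuous_id).matrix_trace)

/-- the chirp vector `(p, q) ↦ y`, `y_i = ι_v((pT)_i) − 2 ι_v(q_i) δ`, is continuous (★ `continuous_toLocalRing`). [cite: CasselsFrohlichANT1967, Ch. II §10] -/
theorem continuous_chirpVector {ι : Type*} [Fintype ι] (T : Matrix ι ι (v.adicCompletion F)) (δ' : LocalRing E v) :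
    Continuous fun pq : (ι → v.adicCompletion F) × (ι → v.adicCompletion F) =>
      fun i => toLocalRing E v ((pq.1 ᵥ* T) i) - 2 * (toLocalRing E v (pq.2 i) * δ') := by
  refine continuous_pi fun i => ?_
  have h1 : Continuous fun pq : (ι → v.adicCompletion F) × (ι → v.adicCompletion F) => (pq.1 ᵥ* T) i :=
    (continuous_apply i).comp (continuous_fst.matrix_vecMul continuous_const)
  have h2 : Continuous fun pq : (ι → v.adicCompletion F) × (ι → v.adicCompletion F) => pq.2 i := (continuous_apply i).comp continuous_snd
  exact ((continuous_toLocalRing E v).comp h1).sub (continuous_const.mul (((continuous_toLocalRing E v).comp h2).mul continuous_const))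

/-- evaluation of an `n″`-tuple of finite adeles at the place `v` is continuous (★ `AdelicGroupData.continuous_finiteAdeleEval`). [cite: CasselsFrohlichANT1967, Ch. II §14] -/
theorem continuous_evalPlace_tuple {m : Type*} (v : HeightOneSpectrum (𝓞 F)) :
    Continuous fun x : m → FiniteAdeleRing (𝓞 F) F => fun i => (x i) v :=
  continuous_pi fun i => (AdelicGroupData.continuous_finiteAdeleEval F v).comp (continuous_apply i)

end LocallyConstant

end Summit.HodgeConjecture.HodgeConjecture.Cruxes.HLiu418.K2LiuFinChirpLocalGramReading

end
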